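import Summits.ResolutionOfSingularities.ResolutionOfSingularities.Theorems.EquisingularLiftEquisingularLiftNatEmbeddedInfinitesimalLiftFactDefs
import Summits.ResolutionOfSingularities.ResolutionOfSingularities.Theorems.EquisingularLiftEquisingularLiftNatLiftOfIdealSheafData
import Summits.ResolutionOfSingularities.ResolutionOfSingularities.Theorems.EquisingularLiftEquisingularLiftNatComapOnCharts
import HarnessLib

/-!
# (β) J1 in chart currency: `EmbeddedInfinitesimalLiftFact` from an ideal sheaf with the right chart values

OURS · L1 W4.5b · EL♮(3) `stmt-ResolutionOfSingularities-20148` · J1c (β) (DESIGN v2 §1) · counted 0 (res-type-027 g16).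
J1 = `EmbeddedInfinitesimalLiftFact` (p596985) asks for a flat closed subscheme `Yₙ' ↪ Wₙ₊₁` restricting to `Yₙ ↪ Wₙ` along the
transition `t : Wₙ ↪ Wₙ₊₁`. By (γ♯) `exists_closedImmersion_flat_isPullback_of_idealSheafData` (p602990) and B1
`comap_eq_of_forall_chart` (…NatComapOnCharts) this is implied by the CHART form stated here as `EmbeddedInfinitesimalChartLiftFact`:
an ideal sheaf `C` on `Wₙ₊₁` with `V(C) → Spec (O ⧸ 𝔪ⁿ⁺²)` flat and, on every affine chart `U ⊆ Wₙ₊₁`,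
`C(U)·Γ(Wₙ, t⁻¹U) = ker (Γ(Wₙ, t⁻¹U) → Γ(Yₙ, ·))` (extension along `t.app U`) — exactly what the affine patching engine (λ)+(ν)+(π) outputs.
[cite: Hartshorne2010, Theorem 6.2 (b) p. 48 and Theorem 9.2 (b) p. 80 (local-to-global form)]
-/

noncomputable section

open CategoryTheory CategoryTheory.Limits AlgebraicGeometry TopologicalSpace
open Literature.AlgebraicGeometry.Morphisms (CechMH1 infinitesimalNeighbourhood)
open Literature.AlgebraicGeometry.HodgeTheory (normalSheaf)

namespace Summit.ResolutionOfSingularities.ResolutionOfSingularities.Cruxes.EquisingularLiftNat.Sections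

/-- The transition `Wₙ ↪ Wₙ₊₁` of infinitesimal neighbourhoods is a closed immersion (both `Wₙ ↪ W`, `Wₙ₊₁ ↪ W` are and
`transition ≫ ι (n+1) = ι n`). [folklore] -/
theorem isClosedImmersion_transition {A : Type} [CommRing A] (I : Ideal A) {X : Scheme.{0}} (f : X ⟶ Spec (.of A)) (n : ℕ) :
    IsClosedImmersion (infinitesimalNeighbourhood.transition I f n) :=
  haveI : IsClosedImmersion (infinitesimalNeighbourhood.transition I f n ≫ infinitesimalNeighbourhood.ι I f (n + 1)) := by
    rw [infinitesimalNeighbourhood.transition_ι]; infer_instance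
  IsClosedImmersion.of_comp_isClosedImmersion (infinitesimalNeighbourhood.transition I f n) (infinitesimalNeighbourhood.ι I f (n + 1))

/-- **J1 in chart currency** (output format of the affine patching engine): same hypotheses as `EmbeddedInfinitesimalLiftFact`; conclusion:
an ideal sheaf `C` on `Wₙ₊₁ = infinitesimalNeighbourhood 𝔪 w (n+1)` with `V(C) → Spec (O ⧸ 𝔪ⁿ⁺²)` flat whose extension to every chart
`t⁻¹U` (`t` the transition, `U ⊆ Wₙ₊₁` affine) is the ideal of `Yₙ` there. [OURS · toward J1; NOT a statement of a source] -/
def EmbeddedInfinitesimalChartLiftFact : Prop :=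
  ∀ (O : Type) [CommRing O] [IsDomain O] [IsDiscreteValuationRing O] (k : Type) [Field k] (θ : O →+* k), Function.Surjective θ →
    ∀ (W : Scheme.{0}) (w : W ⟶ Spec (.of O)) (W₀ : Scheme.{0}) (jW : W₀ ⟶ W) (tW : W₀ ⟶ Spec (.of k)),
      IsPullback jW tW w (Spec.map (CommRingCat.ofHom θ)) → Flat w → LocallyOfFiniteType w →
      ∀ (Y₀ : Scheme.{0}) (ι : Y₀ ⟶ W₀), IsClosedImmersion ι →
        (∀ z : Y₀, ∃ U : W₀.affineOpens, ι.base z ∈ (U : W₀.Opens) ∧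
          ∃ rs : List Γ(W₀, U), RingTheory.Sequence.IsWeaklyRegular Γ(W₀, U) rs ∧ Ideal.ofList rs = ι.ker.ideal U) →
        (∃ V : Fin 2 → Y₀.Opens, (∀ j, IsAffineOpen (V j)) ∧ IsAffineOpen (V 0 ⊓ V 1) ∧ ⨆ j, V j = ⊤ ∧
          Subsingleton (CechMH1 Y₀.toSpecΓ (normalSheaf ι) V)) →
        ∀ (n : ℕ) (Yn : Scheme.{0}) (jn : Yn ⟶ infinitesimalNeighbourhood (IsLocalRing.maximalIdeal O) w n),
          IsClosedImmersion jn → Flat (jn ≫ infinitesimalNeighbourhood.toSpec (IsLocalRing.maximalIdeal O) w n) →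
          (∃ s₀ : Y₀ ⟶ Yn, IsPullback s₀ ι (jn ≫ infinitesimalNeighbourhood.ι (IsLocalRing.maximalIdeal O) w n) jW) →
          ∃ C : (infinitesimalNeighbourhood (IsLocalRing.maximalIdeal O) w (n + 1)).IdealSheafData,
            Flat (C.subschemeι ≫ infinitesimalNeighbourhood.toSpec (IsLocalRing.maximalIdeal O) w (n + 1)) ∧
            ∀ U : (infinitesimalNeighbourhood (IsLocalRing.maximalIdeal O) w (n + 1)).affineOpens,
              (C.ideal U).map ((infinitesimalNeighbourhood.transition (IsLocalRing.maximalIdeal O) w n).app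
                (U : (infinitesimalNeighbourhood (IsLocalRing.maximalIdeal O) w (n + 1)).Opens)).hom =
              RingHom.ker (jn.app (infinitesimalNeighbourhood.transition (IsLocalRing.maximalIdeal O) w n ⁻¹ᵁ
                (U : (infinitesimalNeighbourhood (IsLocalRing.maximalIdeal O) w (n + 1)).Opens))).hom

/-- **(β) assembly.** The chart form implies J1: `EmbeddedInfinitesimalChartLiftFact → EmbeddedInfinitesimalLiftFact`
((γ♯) p602990 + B1 …NatComapOnCharts). [OURS · toward J1] -/
theorem embeddedInfinitesimalLiftFact_of_chartLift (h : EmbeddedInfinitesimalChartLiftFact) : EmbeddedInfinitesimalLiftFact := by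
  intro O _ _ _ k _ θ hθ W w W₀ jW tW hsq hflat hlft Y₀ ι hι hlci hCech n Yn jn hjn hflatn hs₀
  obtain ⟨C, hCflat, hC⟩ := h O k θ hθ W w W₀ jW tW hsq hflat hlft Y₀ ι hι hlci hCech n Yn jn hjn hflatn hs₀
  haveI := isClosedImmersion_transition (IsLocalRing.maximalIdeal O) w n
  refine exists_closedImmersion_flat_isPullback_of_idealSheafData
    (infinitesimalNeighbourhood.transition (IsLocalRing.maximalIdeal O) w n)
    (infinitesimalNeighbourhood.toSpec (IsLocalRing.maximalIdeal O) w (n + 1)) jn C ?_ hCflat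
  refine comap_eq_of_forall_chart _ C jn.ker fun U => ?_
  rw [← Scheme.Hom.app_eq_appLE, hC U, ker_ideal_chart]

end Summit.ResolutionOfSingularities.ResolutionOfSingularities.Cruxes.EquisingularLiftNat.Sections

end
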